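import Mathlib

/-!
# Symmetrisation over the `ℤ/p` translation action (`stub_average`)

Crux stmt-MatrixMultiplication-14309, line clique-coclique-direct-sum-clique, registered stub
`stub_average` (symmetrisation over the ℤ/p translation action: invariant feasible kernels
suffice).

A finite type `V` carries an additive action of `ZMod p` and the support relation `P` on `V` is
invariant under the simultaneous action.  A *feasible kernel* is a map `B : V → V → ℝ` that is
symmetric, positive semidefinite as a real quadratic form, entrywise nonnegative, diagonally
dominant (`B v w ≤ B v v`), supported on `P` and of trace `∑ v, B v v = 1`.  If every
translation-invariant feasible kernel has `∑ v, ∑ w, B v w ≤ T`, then so does every feasible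
kernel: the average `B̄ v w = p⁻¹ ∑ t, B (t +ᵥ v) (t +ᵥ w)` is invariant, is again feasible
(each constraint is invariant and `v ↦ t +ᵥ v` is a permutation of `V`), and has the same trace
and the same total sum as `B`.
-/

namespace Summit.MatrixMultiplication.MatrixMultiplication.Theorems.PrimeCyclicPowerGainTheta.Average

open scoped BigOperators

/-- Reindexing a sum over `V` along the permutation `v ↦ t +ᵥ v` of an additive group action. -/
theorem sum_vadd_eq {G V M : Type*} [AddGroup G] [AddAction G V] [Fintype V]
    [AddCommMonoid M] (t : G) (f : V → M) :
    ∑ v, f (t +ᵥ v) = ∑ v, f v :=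
  Equiv.sum_comp (AddAction.toPerm t) f

/-- Reindexing a double sum over `V × V` along the simultaneous translation by `t`. -/
theorem sum_sum_vadd_eq {G V M : Type*} [AddGroup G] [AddAction G V] [Fintype V]
    [AddCommMonoid M] (t : G) (F : V → V → M) :
    ∑ v, ∑ w, F (t +ᵥ v) (t +ᵥ w) = ∑ v, ∑ w, F v w :=
  calc ∑ v, ∑ w, F (t +ᵥ v) (t +ᵥ w) = ∑ v, ∑ w, F (t +ᵥ v) w :=
        Finset.sum_congr rfl fun v _ => sum_vadd_eq t (F (t +ᵥ v))
    _ = ∑ v, ∑ w, F v w := sum_vadd_eq t (fun v => ∑ w, F v w)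

/-- **Symmetrisation** (the Transfer step of the line `clique-coclique-direct-sum-clique`).
`ℤ/p` acts on a finite `V` and the support predicate `P` is invariant.  If every
translation-invariant feasible kernel has `∑ B ≤ T`, then every feasible kernel does: replace
`B` by `B̄ v w = p⁻¹ ∑ t, B (t +ᵥ v) (t +ᵥ w)`, which is invariant, stays feasible, and has the
same trace and the same total sum. -/
theorem stub_average :
    ∀ (p : ℕ) [Fact p.Prime] (V : Type) [Fintype V] [AddAction (ZMod p) V]
      (P : V → V → Prop) (T : ℝ),
      (∀ (t : ZMod p) (v w : V), P (t +ᵥ v) (t +ᵥ w) ↔ P v w) →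
      (∀ B : V → V → ℝ,
          (∀ (t : ZMod p) (v w : V), B (t +ᵥ v) (t +ᵥ w) = B v w) →
          (∀ v w, B v w = B w v) →
          (∀ x : V → ℝ, 0 ≤ ∑ v, ∑ w, x v * B v w * x w) →
          (∀ v w, 0 ≤ B v w) →
          (∀ v w, B v w ≤ B v v) →
          (∀ v w, B v w ≠ 0 → P v w) →
          ∑ v, B v v = 1 →
          ∑ v, ∑ w, B v w ≤ T) →
      ∀ B : V → V → ℝ,
          (∀ v w, B v w = B w v) →
          (∀ x : V → ℝ, 0 ≤ ∑ v, ∑ w, x v * B v w * x w) →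
          (∀ v w, 0 ≤ B v w) →
          (∀ v w, B v w ≤ B v v) →
          (∀ v w, B v w ≠ 0 → P v w) →
          ∑ v, B v v = 1 →
          ∑ v, ∑ w, B v w ≤ T := by
  intro p hp V _ _ P T hP hT B hsymm hpsd hnn hdom hsupp htr
  have hp0 : (p : ℝ) ≠ 0 := Nat.cast_ne_zero.2 hp.out.ne_zero
  have hpinv : 0 ≤ (p : ℝ)⁻¹ := inv_nonneg.2 (Nat.cast_nonneg p)
  -- one-variable averaging identity
  have havg : ∀ f : V → ℝ, ∑ v, (p : ℝ)⁻¹ * ∑ t : ZMod p, f (t +ᵥ v) = ∑ v, f v := by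
    intro f
    rw [← Finset.mul_sum, Finset.sum_comm, Finset.sum_congr rfl fun t _ => sum_vadd_eq t f,
      Finset.sum_const, Finset.card_univ, ZMod.card, nsmul_eq_mul, ← mul_assoc,
      inv_mul_cancel₀ hp0, one_mul]
  -- two-variable averaging identity
  have havg2 : ∀ F : V → V → ℝ,
      ∑ v, ∑ w, (p : ℝ)⁻¹ * ∑ t : ZMod p, F (t +ᵥ v) (t +ᵥ w) = ∑ v, ∑ w, F v w := by
    intro F
    have h1 : ∀ v, ∑ w, (p : ℝ)⁻¹ * ∑ t : ZMod p, F (t +ᵥ v) (t +ᵥ w)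
        = (p : ℝ)⁻¹ * ∑ t : ZMod p, (fun v' => ∑ w, F v' w) (t +ᵥ v) := by
      intro v
      rw [← Finset.mul_sum, Finset.sum_comm]
      exact congrArg _ (Finset.sum_congr rfl fun t _ => sum_vadd_eq t (F (t +ᵥ v)))
    rw [Finset.sum_congr rfl fun v _ => h1 v]
    exact havg (fun v => ∑ w, F v w)
  -- the averaged kernel
  set Bbar : V → V → ℝ := fun v w => (p : ℝ)⁻¹ * ∑ t : ZMod p, B (t +ᵥ v) (t +ᵥ w) with hBbar
  -- (1) invariance
  have h1 : ∀ (u : ZMod p) (v w : V), Bbar (u +ᵥ v) (u +ᵥ w) = Bbar v w := by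
    intro u v w
    simp only [hBbar, vadd_vadd]
    exact congrArg _ (Equiv.sum_comp (Equiv.addRight u) (fun t => B (t +ᵥ v) (t +ᵥ w)))
  -- (2) symmetry
  have h2 : ∀ v w, Bbar v w = Bbar w v := by
    intro v w
    simp only [hBbar]
    exact congrArg _ (Finset.sum_congr rfl fun t _ => hsymm _ _)
  -- (3) positive semidefiniteness
  have h3 : ∀ x : V → ℝ, 0 ≤ ∑ v, ∑ w, x v * Bbar v w * x w := by
    intro x
    have hx : ∀ t : ZMod p, (0 : ℝ) ≤ ∑ v, ∑ w, x v * B (t +ᵥ v) (t +ᵥ w) * x w := by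
      intro t
      have := hpsd (fun v => x (-t +ᵥ v))
      rw [← sum_sum_vadd_eq t (fun v w => x (-t +ᵥ v) * B v w * x (-t +ᵥ w))] at this
      simpa only [neg_vadd_vadd] using this
    have e1 : ∀ v w, x v * Bbar v w * x w
        = ∑ t : ZMod p, (p : ℝ)⁻¹ * (x v * B (t +ᵥ v) (t +ᵥ w) * x w) := by
      intro v w
      simp only [hBbar, Finset.mul_sum, Finset.sum_mul]
      exact Finset.sum_congr rfl fun t _ => by ring
    have key : ∑ v, ∑ w, x v * Bbar v w * x w
        = (p : ℝ)⁻¹ * ∑ t : ZMod p, ∑ v, ∑ w, x v * B (t +ᵥ v) (t +ᵥ w) * x w :=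
      calc ∑ v, ∑ w, x v * Bbar v w * x w
          = ∑ v, ∑ w, ∑ t : ZMod p, (p : ℝ)⁻¹ * (x v * B (t +ᵥ v) (t +ᵥ w) * x w) :=
            Finset.sum_congr rfl fun v _ => Finset.sum_congr rfl fun w _ => e1 v w
        _ = ∑ v, ∑ t : ZMod p, ∑ w, (p : ℝ)⁻¹ * (x v * B (t +ᵥ v) (t +ᵥ w) * x w) :=
            Finset.sum_congr rfl fun v _ => Finset.sum_comm
        _ = ∑ t : ZMod p, ∑ v, ∑ w, (p : ℝ)⁻¹ * (x v * B (t +ᵥ v) (t +ᵥ w) * x w) :=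
            Finset.sum_comm
        _ = (p : ℝ)⁻¹ * ∑ t : ZMod p, ∑ v, ∑ w, x v * B (t +ᵥ v) (t +ᵥ w) * x w := by
            simp only [Finset.mul_sum]
    rw [key]
    exact mul_nonneg hpinv (Finset.sum_nonneg fun t _ => hx t)
  -- (4) nonnegativity
  have h4 : ∀ v w, 0 ≤ Bbar v w := fun v w =>
    mul_nonneg hpinv (Finset.sum_nonneg fun t _ => hnn _ _)
  -- (5) diagonal dominance
  have h5 : ∀ v w, Bbar v w ≤ Bbar v v := fun v w =>
    mul_le_mul_of_nonneg_left (Finset.sum_le_sum fun t _ => hdom _ _) hpinv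
  -- (6) support
  have h6 : ∀ v w, Bbar v w ≠ 0 → P v w := by
    intro v w hne
    by_contra hPvw
    apply hne
    have hzero : ∀ t : ZMod p, B (t +ᵥ v) (t +ᵥ w) = 0 := by
      intro t
      by_contra hB
      exact hPvw ((hP t v w).1 (hsupp _ _ hB))
    show (p : ℝ)⁻¹ * ∑ t : ZMod p, B (t +ᵥ v) (t +ᵥ w) = 0
    rw [Finset.sum_eq_zero fun t _ => hzero t, mul_zero]
  -- (7) trace
  have h7 : ∑ v, Bbar v v = 1 := (havg (fun v => B v v)).trans htr
  -- (8) value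
  have h8 : ∑ v, ∑ w, Bbar v w = ∑ v, ∑ w, B v w := havg2 B
  calc ∑ v, ∑ w, B v w = ∑ v, ∑ w, Bbar v w := h8.symm
    _ ≤ T := hT Bbar h1 h2 h3 h4 h5 h6 h7

end Summit.MatrixMultiplication.MatrixMultiplication.Theorems.PrimeCyclicPowerGainTheta.Average
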